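import Mathlib
import Literature.MathematicalPhysics.QuantumFieldTheory.Balaban1983to89.B1Eq324BenfattoClassAppendixC
import HarnessLib

/-!
# `Balaban1983to89.B1Eq324BenfattoClassCentreLocality` — F9′: the QUANTITATIVE LOCALITY of the conditional centre for the class of
# [Balaban1985BackgroundPropagators] Sect. E p. 428 (exponentially decaying precision): changing the boundary data at distance `≥ D` from `y`
# moves the centre `u_y` by at most `const·t·e^{−(κ/2)D}` — the substitute for [BenfattoEtAl1978]'s exact Markov locality of (C.7), PROVED

statement-level skeleton of published theorems with citation tags; proofs where landed; nothing here is a claim about the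
Yang–Mills mass gap

WHY THIS MODULE (cell `pub-ymgap`, seat `dag-n08-b` gen 8; located row F9′ of seat dag-n08-c's kernel census
`N08-BASICLEMMA-KERNEL-CENSUS.md` v1.1 §6, worded «yours by stem»).  In [BenfattoEtAl1978] the conditional centre (C.7)
`u_Δ = β Σ_{Δ′⊂Γ}(Σ_{Δ″∉Γ, n.n. Δ′} C^Γ_{ΔΔ″}) z_{Δ′}` of the nearest-neighbour field is EXACTLY local: inside a region enclosed by `Γ` it reads
only the boundary data adjacent to the region (tree: `B1Eq324BenfattoMarkov.condMean_freeCov_congr_of_enclosed`, consumed by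
`B1Eq324BenfattoSect5LegGeometry.condMean_eq_condMean_frame1` — census row F9).  At T. Bałaban's data the precision is exponentially decaying,
not finite-range ([Balaban1985BackgroundPropagators] p. 428, (3.156)), the centre is `u = −(A|_{Γᶜ})⁻¹A_{ΓᶜΓ}ξ`
(`B1Eq324BenfattoClassAppendixC.regression_apply_eq`) and reads ALL boundary data — with exponentially decaying weights.  F9′ is the
quantitative replacement: by linearity (`regression_sub`) and the (C.8)-class bound (`abs_regression_le`) applied to `ξ − ξ′`, two boundary data
that agree on the sites of `Γ` within distance `D` of `y` give centres differing at `y` by at most `(V₂M₂/(γ − J))·t·e^{−(κ/2)D}` (`t` = the size of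
the far difference), or, with print's growing thresholds `|ξ_c − ξ′_c| ≤ t(1 + δ_c)`, by `(V′M′/(γ − J))·t(1 + δ_y)·e^{−(κ/2)D}`.

THE PRINTED TEXT whose class form this serves (p. 164, (C.7)): *«… center `u_Δ = β Σ_{Δ′⊂Γ} (Σ_{Δ″∉Γ, Δ″ n.n. to Δ′} C^Γ_{ΔΔ″}) z_{Δ′}`»* —
for the nearest-neighbour field only the `Δ′` adjacent to the component of `Δ` contribute.

DICTIONARY.  As in `B1Eq324BenfattoClassAppendixC`: finite index set `ι` with a pseudometric `dist`; symmetric precision `A`, `γ`-coercive, with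
Combes–Thomas rows `Σ_{e′}|A e e′|(cosh(κ·dist e e′) − 1) ≤ J < γ`; `G = A⁻¹`; the `condMean`-body (regression)
`u_y(ξ) = Σ_{c,c′∈Γ} G_{yc}(G_ΓΓ)⁻¹_{cc′}ξ_{c′}`; growth constants at half rate `Σ_{e′}e^{−(κ/2)dist e e′} ≤ V₂`, `Σ_{e′}|A e e′|e^{(κ/2)dist e e′} ≤ M₂`
(the constants of `abs_cov_sub_schur_le_exp`), and their `(1 + dist)`-weighted variants `V′`, `M′` for the profile edition.

WHAT IS PROVED (no definition, no named fact, no `sorry`; axioms standard).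
* ★★ `abs_regression_sub_le_exp` (F9′, uniform far difference): `ξ = ξ′` on `{c ∈ Γ : dist y c < D}`, `|ξ_c − ξ′_c| ≤ t` on `Γ`
  ⟹ `|u_y(ξ) − u_y(ξ′)| ≤ (V₂M₂/(γ − J))·t·e^{−(κ/2)D}`.
* ★ `abs_regression_sub_le_exp_profile` (F9′ with print's growing thresholds): `|ξ_c − ξ′_c| ≤ t(1 + δ_c)` on `Γ` for a nonnegative
  1-Lipschitz profile `δ`, `ξ = ξ′` on the `Γ`-sites within `D` of `y` ⟹ `|u_y(ξ) − u_y(ξ′)| ≤ (V′M′/(γ − J))·t·(1 + δ_y)·e^{−(κ/2)D}` with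
  `Σ_{e′}e^{−(κ/2)dist e e′}(1 + dist e e′) ≤ V′`, `Σ_{e′}|A e e′|e^{(κ/2)dist e e′}(1 + dist e e′) ≤ M′`.
* `abs_regression_far_le_exp` (the far part of the centre alone: data supported at distance `≥ D` from `y`, `|ξ| ≤ t` ⟹
  `|u_y(ξ)| ≤ (V₂M₂/(γ − J))·t·e^{−(κ/2)D}`) — the lemma both editions reduce to.

HONEST SCOPE.  Kernel-generic matrix analysis; the class is OUR reading of [Balaban1982Higgs1] p. 616 «all the assumptions are satisfied» at
[Balaban1985BackgroundPropagators]'s propagators, not print; the §5-side consumer (`…Sect5LegGeometry.condMean_eq_condMean_frame1`'s class twin: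
an extra error term instead of an identity) is NOT typed (plan g81: the port is not commissioned beyond definition-free pieces); nothing of
[Balaban1985UV3] / [Balaban1985BackgroundPropagators] asserted; N08 NOT discharged; count-neutral; nothing continuum / OS / mass-gap / Clay.
-/

noncomputable section

open Finset Matrix
open scoped BigOperators

namespace Literature.MathematicalPhysics.QuantumFieldTheory.Balaban1983to89.B1Eq324BenfattoClassCentreLocality

open Literature.MathematicalPhysics.QuantumFieldTheory
open Literature.MathematicalPhysics.QuantumFieldTheory.Balaban1983to89.B1Eq324BenfattoClassAppendixC

variable {ι : Type*} [Fintype ι] [DecidableEq ι]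
variable {A : Matrix ι ι ℝ} {dist : ι → ι → ℝ} {γ J κ : ℝ}

omit [Fintype ι] [DecidableEq ι] in
/-- A pseudometric in the three axioms used here takes nonnegative values. [folklore] -/
private theorem dist_nonneg_of_axioms' (hd0 : ∀ e, dist e e = 0)
    (hdsymm : ∀ e e', dist e e' = dist e' e) (hdtri : ∀ e e' e'', dist e e'' ≤ dist e e' + dist e' e'')
    (e e' : ι) : 0 ≤ dist e e' := by
  have h := hdtri e e' e
  rw [hd0, hdsymm e' e] at h
  linarith

/-- **The far part of the conditional centre is exponentially small**: if the boundary data `ξ` vanish on every `c ∈ Γ` with `dist y c < D`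
and `|ξ_c| ≤ t` on `Γ`, then `|u_y(ξ)| ≤ (V₂M₂/(γ − J))·t·e^{−(κ/2)D}` — each weight `e^{−κ·dist y z}|A_{zc}|` of `abs_regression_le` with
`dist y c ≥ D` splits as `e^{−(κ/2)dist y z}·(|A_{zc}|e^{(κ/2)dist z c})·e^{−(κ/2)D}` by the triangle inequality.
[cite: BenfattoEtAl1978, Appendix C (C.7)–(C.8) p.164 (class form; quantitative locality)] -/
theorem abs_regression_far_le_exp (hA : ∀ e e', A e e' = A e' e)
    (hd0 : ∀ e, dist e e = 0) (hdsymm : ∀ e e', dist e e' = dist e' e)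
    (hdtri : ∀ e e' e'', dist e e'' ≤ dist e e' + dist e' e'') (hγ0 : 0 < γ)
    (hγ : ∀ x : ι → ℝ, γ * ∑ e, x e ^ 2 ≤ ∑ e, ∑ e', A e e' * x e * x e')
    (hJ : ∀ e, ∑ e', |A e e'| * (Real.cosh (κ * dist e e') - 1) ≤ J) (hκ : 0 ≤ κ) (hm : J < γ)
    {V₂ M₂ : ℝ} (hV : ∀ e, ∑ e', Real.exp (-(κ / 2 * dist e e')) ≤ V₂)
    (hM : ∀ e, ∑ e', |A e e'| * Real.exp (κ / 2 * dist e e') ≤ M₂)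
    (Γ : Finset ι) (ξ : ι → ℝ) (y : ↥Γᶜ) {t D : ℝ} (ht : 0 ≤ t)
    (hnear : ∀ c ∈ Γ, dist y c < D → ξ c = 0) (hfar : ∀ c ∈ Γ, |ξ c| ≤ t) :
    |∑ c : Γ, ∑ c' : Γ, A⁻¹ y c * (covGram (A⁻¹ : Matrix ι ι ℝ) Γ)⁻¹ c c' * ξ c'| ≤
      V₂ * M₂ / (γ - J) * t * Real.exp (-(κ / 2 * D)) := by
  have hdnn := dist_nonneg_of_axioms' hd0 hdsymm hdtri
  have hγJ : 0 < γ - J := by linarith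
  refine (abs_regression_le hA hd0 hdsymm hdtri hγ0 hγ hJ hκ hm Γ ξ y).trans ?_
  -- termwise: `e^{−κ d(y,z)}|A z c||ξ c| ≤ t e^{−(κ/2)D} · e^{−(κ/2)d(y,z)} · (|A z c| e^{(κ/2) d(z,c)})`
  have hterm : ∀ (z : ι) (c : ι), c ∈ Γ →
      Real.exp (-(κ * dist y z)) * (|A z c| * |ξ c|) ≤
        t * Real.exp (-(κ / 2 * D)) * (Real.exp (-(κ / 2 * dist y z)) * (|A z c| * Real.exp (κ / 2 * dist z c))) := by
    intro z c hc
    by_cases hD : dist y c < D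
    · rw [hnear c hc hD, abs_zero, mul_zero, mul_zero]
      positivity
    · rw [not_lt] at hD
      have hexp : Real.exp (-(κ * dist y z)) ≤
          Real.exp (-(κ / 2 * D)) * (Real.exp (-(κ / 2 * dist y z)) * Real.exp (κ / 2 * dist z c)) := by
        rw [← Real.exp_add, ← Real.exp_add]
        refine Real.exp_le_exp.mpr ?_
        have h1 := hdtri (y : ι) z c
        have h2 := hdnn (y : ι) z
        nlinarith
      calc Real.exp (-(κ * dist y z)) * (|A z c| * |ξ c|)
          ≤ (Real.exp (-(κ / 2 * D)) * (Real.exp (-(κ / 2 * dist y z)) * Real.exp (κ / 2 * dist z c))) *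
              (|A z c| * t) :=
            mul_le_mul hexp (mul_le_mul_of_nonneg_left (hfar c hc) (abs_nonneg _)) (by positivity) (by positivity)
        _ = _ := by ring
  have hin : ∀ z : ι, Real.exp (-(κ * dist y z)) * ∑ c : Γ, |A z c| * |ξ c| ≤
      t * Real.exp (-(κ / 2 * D)) * (Real.exp (-(κ / 2 * dist y z)) * M₂) := by
    intro z
    rw [Finset.mul_sum]
    calc ∑ c : Γ, Real.exp (-(κ * dist y z)) * (|A z c| * |ξ c|)
        ≤ ∑ c : Γ, t * Real.exp (-(κ / 2 * D)) * (Real.exp (-(κ / 2 * dist y z)) * (|A z c| * Real.exp (κ / 2 * dist z c))) :=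
          Finset.sum_le_sum fun c _ => hterm z c c.2
      _ = t * Real.exp (-(κ / 2 * D)) * (Real.exp (-(κ / 2 * dist y z)) *
            ∑ c : Γ, |A z c| * Real.exp (κ / 2 * dist z c)) := by
          rw [Finset.mul_sum, Finset.mul_sum]
      _ ≤ t * Real.exp (-(κ / 2 * D)) * (Real.exp (-(κ / 2 * dist y z)) * M₂) := by
          refine mul_le_mul_of_nonneg_left (mul_le_mul_of_nonneg_left ?_ (Real.exp_pos _).le) (by positivity)
          have h := Finset.sum_coe_sort Γ (fun c => |A z c| * Real.exp (κ / 2 * dist z c))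
          rw [h]
          exact le_trans (Finset.sum_le_univ_sum_of_nonneg fun c => by positivity) (hM z)
  have hM0 : 0 ≤ M₂ := le_trans (Finset.sum_nonneg fun e' _ => by positivity) (hM y)
  have hout : ∑ z : ↥Γᶜ, Real.exp (-(κ * dist y z)) * ∑ c : Γ, |A z c| * |ξ c| ≤
      t * Real.exp (-(κ / 2 * D)) * M₂ * V₂ := by
    calc ∑ z : ↥Γᶜ, Real.exp (-(κ * dist y z)) * ∑ c : Γ, |A z c| * |ξ c|
        ≤ ∑ z : ↥Γᶜ, t * Real.exp (-(κ / 2 * D)) * (Real.exp (-(κ / 2 * dist y z)) * M₂) :=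
          Finset.sum_le_sum fun z _ => hin z
      _ = t * Real.exp (-(κ / 2 * D)) * M₂ * ∑ z : ↥Γᶜ, Real.exp (-(κ / 2 * dist y z)) := by
          rw [Finset.mul_sum]
          exact Finset.sum_congr rfl fun z _ => by ring
      _ ≤ t * Real.exp (-(κ / 2 * D)) * M₂ * V₂ := by
          refine mul_le_mul_of_nonneg_left ?_ (by positivity)
          have h := Finset.sum_coe_sort Γᶜ (fun z => Real.exp (-(κ / 2 * dist y z)))
          rw [h]
          exact le_trans (Finset.sum_le_univ_sum_of_nonneg fun z => (Real.exp_pos _).le) (hV y)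
  calc 1 / (γ - J) * ∑ z : ↥Γᶜ, Real.exp (-(κ * dist y z)) * ∑ c : Γ, |A z c| * |ξ c|
      ≤ 1 / (γ - J) * (t * Real.exp (-(κ / 2 * D)) * M₂ * V₂) := mul_le_mul_of_nonneg_left hout (by positivity)
    _ = V₂ * M₂ / (γ - J) * t * Real.exp (-(κ / 2 * D)) := by
        field_simp

/-- **F9′ — QUANTITATIVE LOCALITY OF THE CONDITIONAL CENTRE (uniform far difference).**  For `A` in the class and two boundary data `ξ, ξ′`
on `Γ` that AGREE on every `c ∈ Γ` with `dist y c < D` and differ by at most `t` elsewhere,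
`|u_y(ξ) − u_y(ξ′)| ≤ (V₂M₂/(γ − J))·t·e^{−(κ/2)D}` — the substitute, at an exponentially decaying precision, for the exact locality
`condMean_freeCov_congr_of_enclosed` of the nearest-neighbour field (census row F9 ↦ F9′: an extra error term instead of an identity).
[cite: BenfattoEtAl1978, Appendix C (C.7)–(C.8) p.164 (class form; quantitative locality)] -/
theorem abs_regression_sub_le_exp (hA : ∀ e e', A e e' = A e' e)
    (hd0 : ∀ e, dist e e = 0) (hdsymm : ∀ e e', dist e e' = dist e' e)
    (hdtri : ∀ e e' e'', dist e e'' ≤ dist e e' + dist e' e'') (hγ0 : 0 < γ)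
    (hγ : ∀ x : ι → ℝ, γ * ∑ e, x e ^ 2 ≤ ∑ e, ∑ e', A e e' * x e * x e')
    (hJ : ∀ e, ∑ e', |A e e'| * (Real.cosh (κ * dist e e') - 1) ≤ J) (hκ : 0 ≤ κ) (hm : J < γ)
    {V₂ M₂ : ℝ} (hV : ∀ e, ∑ e', Real.exp (-(κ / 2 * dist e e')) ≤ V₂)
    (hM : ∀ e, ∑ e', |A e e'| * Real.exp (κ / 2 * dist e e') ≤ M₂)
    (Γ : Finset ι) (ξ ξ' : ι → ℝ) (y : ↥Γᶜ) {t D : ℝ} (ht : 0 ≤ t)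
    (hnear : ∀ c ∈ Γ, dist y c < D → ξ c = ξ' c) (hfar : ∀ c ∈ Γ, |ξ c - ξ' c| ≤ t) :
    |(∑ c : Γ, ∑ c' : Γ, A⁻¹ y c * (covGram (A⁻¹ : Matrix ι ι ℝ) Γ)⁻¹ c c' * ξ c') -
        ∑ c : Γ, ∑ c' : Γ, A⁻¹ y c * (covGram (A⁻¹ : Matrix ι ι ℝ) Γ)⁻¹ c c' * ξ' c'| ≤
      V₂ * M₂ / (γ - J) * t * Real.exp (-(κ / 2 * D)) := by
  rw [regression_sub (A⁻¹ : Matrix ι ι ℝ) Γ ξ ξ' y]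
  exact abs_regression_far_le_exp hA hd0 hdsymm hdtri hγ0 hγ hJ hκ hm hV hM Γ (fun c => ξ c - ξ' c) y ht
    (fun c hc hD => sub_eq_zero.mpr (hnear c hc hD)) hfar

/-- **F9′ with print's growing thresholds.**  If the two boundary data differ by at most `t(1 + δ_c)` on `Γ` for a nonnegative profile `δ`
that is 1-Lipschitz for `dist` (print: `δ = d(·, I)`), and agree on the `Γ`-sites within `D` of `y`, then
`|u_y(ξ) − u_y(ξ′)| ≤ (V′M′/(γ − J))·t·(1 + δ_y)·e^{−(κ/2)D}` with the `(1 + dist)`-weighted half-rate growth constants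
`Σ_{e′}e^{−(κ/2)dist e e′}(1 + dist e e′) ≤ V′`, `Σ_{e′}|A e e′|e^{(κ/2)dist e e′}(1 + dist e e′) ≤ M′`.
[cite: BenfattoEtAl1978, Appendix C (C.7)–(C.8) p.164 (class form; quantitative locality, growing thresholds)] -/
theorem abs_regression_sub_le_exp_profile (hA : ∀ e e', A e e' = A e' e)
    (hd0 : ∀ e, dist e e = 0) (hdsymm : ∀ e e', dist e e' = dist e' e)
    (hdtri : ∀ e e' e'', dist e e'' ≤ dist e e' + dist e' e'') (hγ0 : 0 < γ)
    (hγ : ∀ x : ι → ℝ, γ * ∑ e, x e ^ 2 ≤ ∑ e, ∑ e', A e e' * x e * x e')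
    (hJ : ∀ e, ∑ e', |A e e'| * (Real.cosh (κ * dist e e') - 1) ≤ J) (hκ : 0 ≤ κ) (hm : J < γ)
    {V' M' t : ℝ} (hV : ∀ e, ∑ e', Real.exp (-(κ / 2 * dist e e')) * (1 + dist e e') ≤ V')
    (hM : ∀ e, ∑ e', |A e e'| * Real.exp (κ / 2 * dist e e') * (1 + dist e e') ≤ M') (ht : 0 ≤ t)
    (δ : ι → ℝ) (hδ0 : ∀ e, 0 ≤ δ e) (hδ : ∀ e e', δ e' ≤ δ e + dist e e')
    (Γ : Finset ι) (ξ ξ' : ι → ℝ) (y : ↥Γᶜ) {D : ℝ}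
    (hnear : ∀ c ∈ Γ, dist y c < D → ξ c = ξ' c) (hfar : ∀ c ∈ Γ, |ξ c - ξ' c| ≤ t * (1 + δ c)) :
    |(∑ c : Γ, ∑ c' : Γ, A⁻¹ y c * (covGram (A⁻¹ : Matrix ι ι ℝ) Γ)⁻¹ c c' * ξ c') -
        ∑ c : Γ, ∑ c' : Γ, A⁻¹ y c * (covGram (A⁻¹ : Matrix ι ι ℝ) Γ)⁻¹ c c' * ξ' c'| ≤
      V' * M' / (γ - J) * t * (1 + δ y) * Real.exp (-(κ / 2 * D)) := by
  have hdnn := dist_nonneg_of_axioms' hd0 hdsymm hdtri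
  have hγJ : 0 < γ - J := by linarith
  rw [regression_sub (A⁻¹ : Matrix ι ι ℝ) Γ ξ ξ' y]
  set η : ι → ℝ := fun c => ξ c - ξ' c with hη
  refine (abs_regression_le hA hd0 hdsymm hdtri hγ0 hγ hJ hκ hm Γ η y).trans ?_
  -- termwise bound
  have hterm : ∀ (z : ι) (c : ι), c ∈ Γ →
      Real.exp (-(κ * dist y z)) * (|A z c| * |η c|) ≤
        t * (1 + δ y) * Real.exp (-(κ / 2 * D)) *
          ((Real.exp (-(κ / 2 * dist y z)) * (1 + dist y z)) * (|A z c| * Real.exp (κ / 2 * dist z c) * (1 + dist z c))) := by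
    intro z c hc
    by_cases hD : dist y c < D
    · have h0 : η c = 0 := sub_eq_zero.mpr (hnear c hc hD)
      rw [h0, abs_zero, mul_zero, mul_zero]
      have := hδ0 (y : ι); have := hdnn (y : ι) z; have := hdnn z c
      positivity
    · rw [not_lt] at hD
      have hexp : Real.exp (-(κ * dist y z)) ≤
          Real.exp (-(κ / 2 * D)) * (Real.exp (-(κ / 2 * dist y z)) * Real.exp (κ / 2 * dist z c)) := by
        rw [← Real.exp_add, ← Real.exp_add]
        refine Real.exp_le_exp.mpr ?_
        have h1 := hdtri (y : ι) z c
        have h2 := hdnn (y : ι) z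
        nlinarith
      have hgrow : 1 + δ c ≤ (1 + δ y) * (1 + dist y z) * (1 + dist z c) := by
        have := hδ (y : ι) z; have := hδ z c; have := hδ0 (y : ι); have := hdnn (y : ι) z; have := hdnn z c
        nlinarith [mul_nonneg (hδ0 y) (hdnn y z), mul_nonneg (mul_nonneg (hδ0 y) (hdnn y z)) (hdnn z c),
          mul_nonneg (hδ0 y) (hdnn z c), mul_nonneg (hdnn y z) (hdnn z c)]
      have hηc : |η c| ≤ t * ((1 + δ y) * (1 + dist y z) * (1 + dist z c)) :=
        (hfar c hc).trans (mul_le_mul_of_nonneg_left hgrow ht)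
      calc Real.exp (-(κ * dist y z)) * (|A z c| * |η c|)
          ≤ (Real.exp (-(κ / 2 * D)) * (Real.exp (-(κ / 2 * dist y z)) * Real.exp (κ / 2 * dist z c))) *
              (|A z c| * (t * ((1 + δ y) * (1 + dist y z) * (1 + dist z c)))) :=
            mul_le_mul hexp (mul_le_mul_of_nonneg_left hηc (abs_nonneg _)) (by positivity) (by positivity)
        _ = _ := by ring
  have hin : ∀ z : ι, Real.exp (-(κ * dist y z)) * ∑ c : Γ, |A z c| * |η c| ≤
      t * (1 + δ y) * Real.exp (-(κ / 2 * D)) * ((Real.exp (-(κ / 2 * dist y z)) * (1 + dist y z)) * M') := by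
    intro z
    rw [Finset.mul_sum]
    have hpre : 0 ≤ t * (1 + δ y) * Real.exp (-(κ / 2 * D)) * (Real.exp (-(κ / 2 * dist y z)) * (1 + dist y z)) := by
      have := hδ0 (y : ι); have := hdnn (y : ι) z; positivity
    calc ∑ c : Γ, Real.exp (-(κ * dist y z)) * (|A z c| * |η c|)
        ≤ ∑ c : Γ, t * (1 + δ y) * Real.exp (-(κ / 2 * D)) *
            ((Real.exp (-(κ / 2 * dist y z)) * (1 + dist y z)) * (|A z c| * Real.exp (κ / 2 * dist z c) * (1 + dist z c))) :=
          Finset.sum_le_sum fun c _ => hterm z c c.2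
      _ = t * (1 + δ y) * Real.exp (-(κ / 2 * D)) * (Real.exp (-(κ / 2 * dist y z)) * (1 + dist y z)) *
            ∑ c : Γ, |A z c| * Real.exp (κ / 2 * dist z c) * (1 + dist z c) := by
          rw [Finset.mul_sum]
          exact Finset.sum_congr rfl fun c _ => by ring
      _ ≤ t * (1 + δ y) * Real.exp (-(κ / 2 * D)) * (Real.exp (-(κ / 2 * dist y z)) * (1 + dist y z)) * M' := by
          refine mul_le_mul_of_nonneg_left ?_ hpre
          have h := Finset.sum_coe_sort Γ (fun c => |A z c| * Real.exp (κ / 2 * dist z c) * (1 + dist z c))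
          rw [h]
          exact le_trans (Finset.sum_le_univ_sum_of_nonneg fun c => by
            have := hdnn z c; positivity) (hM z)
      _ = _ := by ring
  have hM0 : 0 ≤ M' := le_trans (Finset.sum_nonneg fun e' _ => by have := hdnn (y : ι) e'; positivity) (hM y)
  have hout : ∑ z : ↥Γᶜ, Real.exp (-(κ * dist y z)) * ∑ c : Γ, |A z c| * |η c| ≤
      t * (1 + δ y) * Real.exp (-(κ / 2 * D)) * M' * V' := by
    calc ∑ z : ↥Γᶜ, Real.exp (-(κ * dist y z)) * ∑ c : Γ, |A z c| * |η c|
        ≤ ∑ z : ↥Γᶜ, t * (1 + δ y) * Real.exp (-(κ / 2 * D)) *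
            ((Real.exp (-(κ / 2 * dist y z)) * (1 + dist y z)) * M') := Finset.sum_le_sum fun z _ => hin z
      _ = t * (1 + δ y) * Real.exp (-(κ / 2 * D)) * M' *
            ∑ z : ↥Γᶜ, Real.exp (-(κ / 2 * dist y z)) * (1 + dist y z) := by
          rw [Finset.mul_sum]
          exact Finset.sum_congr rfl fun z _ => by ring
      _ ≤ t * (1 + δ y) * Real.exp (-(κ / 2 * D)) * M' * V' := by
          refine mul_le_mul_of_nonneg_left ?_ (by have := hδ0 (y : ι); positivity)
          have h := Finset.sum_coe_sort Γᶜ (fun z => Real.exp (-(κ / 2 * dist y z)) * (1 + dist y z))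
          rw [h]
          exact le_trans (Finset.sum_le_univ_sum_of_nonneg fun z => by
            have := hdnn (y : ι) z; positivity) (hV y)
  calc 1 / (γ - J) * ∑ z : ↥Γᶜ, Real.exp (-(κ * dist y z)) * ∑ c : Γ, |A z c| * |η c|
      ≤ 1 / (γ - J) * (t * (1 + δ y) * Real.exp (-(κ / 2 * D)) * M' * V') :=
        mul_le_mul_of_nonneg_left hout (by positivity)
    _ = V' * M' / (γ - J) * t * (1 + δ y) * Real.exp (-(κ / 2 * D)) := by
        field_simp

end Literature.MathematicalPhysics.QuantumFieldTheory.Balaban1983to89.B1Eq324BenfattoClassCentreLocality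

end
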